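/-
COR-CM (cell pub-hodgecm2, stage 2 of the Hodge ladder) — Δ2 BRIDGE, the μ ↦ μᶜ ADAPTER: SMOOTHNESS of the summands at the CONJUGATE
rests BY VALUE, and the A-side pay-off «`Hom_E(A_K, A_ν)_ℚ ≠ 0` below a threshold» from [Liu2021, Thm. 4.18] AS PRINTED at the conjugate
rest WITHOUT [Def. 4.11] (only smoothness of ONE non-zero admissible summand is consumed there, ✔ `Thm418Data.exists_homK_ne_zero_of_isSmoothRep`).
Seat prover-pub-hodgecm2-item6-p3-g16-0 (item6-p3 gen 16, X3-ω ∕ item-(vi) lineage), 2026-08-24.  NEW additive leaf; THEOREMS ONLY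
(kernel lane): no definition, no instance, no named fact, no `sorry`; nothing landed is edited or restated; count-neutral.
HC_CM is NOT proved; «Δ2 BRIDGE CLOSED» is NOT claimed.
-/
import Summits.HodgeConjecture.CorCM.D2Bridge.AdapterMuConj
import Summits.HodgeConjecture.CorCM.B01.Transposition.Item6UniformOmegaRep
import Literature.NumberTheory.Automorphic.Liu2021.Thm418InvariantsAsPrinted
import HarnessLib

set_option autoImplicit false

/-!
# The μ ↦ μᶜ adapter: smooth summands at the conjugate rests, by value

[Liu2021] Y. Liu, *Fourier–Jacobi cycles and arithmetic relative trace formula*, Camb. J. Math. **9** (2021) = arXiv:2102.11518.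

`muConj U` (✔ `AdapterMuConj.lean`) re-labels the μ-uniform oscillator carriers `U : UniformOmega C` by `ν ↦ νᶜ` ([Liu2021] Rem. 4.4):
the summand of [Thm. 4.18]'s direct sum at an admissible index `j = (ε, χ)` of the `ν`-rest of `muConj U` IS the summand of `U` at the
index `(ε, χ)` of its `νᶜ`-rest — same carrier, same `𝔾(𝔸_F^∞)`-action (`rfl`, ✔ `omegaAtMuConj_smul`).  Hence:

* `isSmoothRep_rhoAt_muConj_rest` (§1, any `U`, any tails, `μ = νᶜ`) — smoothness ([Def. 4.11]: every vector fixed by an open subgroup)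
  of every summand at the `ν`-rest of `muConj U` from smoothness of every summand at the `μ`-rest of `U`; likewise
  `isIrreducibleOrZero_rhoAt_muConj_rest`;
* `exists_homK_ne_zero_muConj_rest_of_isSmoothRep` (§2) — [Thm. 4.18] AS PRINTED at the `ν`-rest of `muConj U` (the END's displayed
  `hLiuC` row at `ν`), an object `D_ν ∈ 𝒜(ν)`, ONE non-zero admissible summand there, and smoothness at the `νᶜ`-rest of `U` ⟹
  `Hom_E(A_K, A_ν)_ℚ ≠ 0` at every open compact `K` below a threshold (✔ `Thm418Data.exists_homK_ne_zero_of_isSmoothRep`: «irreducible» and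
  «admissible» are NOT used) — the [Def. 4.11]-free form of ✔ `Thm418Data.exists_homK_ne_zero_of_def411`;
* `Model.rhoAt_muConj_uniformOmegaRep_rest_smooth` (§3, the model's μ-uniform carriers `Model.uniformOmegaRep … δ′ r` of ✔
  `Item6UniformOmegaRep.lean`, `ιV` continuous, one-object tails `restTailOne …`) — smoothness at EVERY conjugate rest
  `(muConj (uniformOmegaRep …)).rest (restTailOne … ν …)` is a THEOREM (✔ `rhoAt_restOfCharRep_smooth` at `νᶜ`, [GR91] Prop. 3.1.1's
  locally constant splittings, moved along ✔ `restOfCharRep_eq_rest`), and `Model.exists_homK_ne_zero_muConj_uniformOmegaRep_rest` —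
  the pay-off at the model: from `hLiuC` at `ν`, an object and one non-zero admissible summand ONLY.

So a consumer that derives `∃ φ : Hom_E(A_K, A_ν)_ℚ, φ ≠ 0` at a conjugate rest need not display [Liu2021, Def. 4.11].
Nothing of [Liu2021] is asserted: `hLiuC` is a hypothesis of its consumer.

## References
* [Liu2021] Def. 4.11 (FJcycle.tex ll. 2083–2097), Rem. 4.4 (ll. 1912–1933), Thm. 4.18 main clause and (1) (ll. 2232–2239).
* [GelbartRogawski1991] S. Gelbart, J. Rogawski, *L-functions and Fourier–Jacobi coefficients for the unitary group U(3)*,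
  Invent. Math. **105** (1991), §3.1 Prop. 3.1.1 p. 455 L1–3.
* Tree: `CorCM/D2Bridge/AdapterMuConj.lean` (`muConj`, `admIndexMuConjEquiv`), `Liu2021/Thm418InvariantsAsPrinted.lean`
  (`exists_homK_ne_zero_of_isSmoothRep`), `B01/Transposition/Item6UniformOmegaRep.lean` + `Item6RestOfCharRep.lean`
  (`uniformOmegaRep`, `restOfCharRep_eq_rest`, `rhoAt_restOfCharRep_smooth`), `Liu2021/Def411AsPrinted.lean` (`IsSmoothRep`, `IsIrreducibleOrZero`).
-/

noncomputable section

namespace Summit.HodgeConjecture.CorCM.D2Bridge.AdapterMuConj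

open NumberField
open Literature.NumberTheory.Automorphic Literature.NumberTheory.Automorphic.IdeleClassGroup
open Literature.NumberTheory.Automorphic.Liu2021 Literature.NumberTheory.Automorphic.Liu2021.AppendixC
open Literature.RepresentationTheory

section Generic

/- As in `AdapterMuConj.lean` §1 ∕ `AdapterMuConjLegs.lean`: every structure ∕ class parameter of the App-C context is IMPLICIT, the CM-field
instance on `E` is AppendixC's `isCMField F E` (`letI`). -/
variable {F E : Type} {iF₁ : Field F} {iF₂ : NumberField F} {iF₃ : IsTotallyReal F} {iE₁ : Field E} {iE₂ : NumberField E}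
  {iA : Algebra F E} {iE₃ : IsTotallyComplex E} {iQ : Algebra.IsQuadraticExtension F E}
variable {P5 : PropC5Data F E} {isotropicAt : ℕ → Prop} {C : Sec42Data P5 isotropicAt}
variable (U : UniformOmega C)

/-! ## §1 Smoothness and irreducibility transfer to the conjugate rests (`μ = νᶜ`) -/

/-- **Smooth summands at the `ν`-rest of `muConj U` from smooth summands at the `μ`-rest of `U`** (`μ = νᶜ`): the summand at the
admissible index `j = (ε, χ)` of `(muConj U).rest tc` IS `U`'s summand `ω(νᶜ, ε, χ)` with the same `𝔾(𝔸_F^∞)`-action, and `(ε, χ)` is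
admissible at the `μ`-rest of `U` (✔ `admIndexMuConjEquiv`).  «Smooth» = [Liu2021, Def. 4.11]'s «admissible representation», first half
(every vector is fixed by an open subgroup, `IsSmoothRep`). [cite: Liu2021, Def. 4.11 (FJcycle.tex ll. 2092–2096); Rem. 4.4 (ll. 1912–1930)] -/
theorem isSmoothRep_rhoAt_muConj_rest {μ ν : Literature.NumberTheory.Automorphic.IdeleClassGroup E →ₜ* Circle}
    {hμ : letI : IsCMField E := isCMField F E; IdeleClassGroup.IsConjugateSymplectic E μ}
    {hν : letI : IsCMField E := isCMField F E; IdeleClassGroup.IsConjugateSymplectic E ν}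
    (t : RestTail C μ hμ) (tc : RestTail C ν hν)
    (h : letI : IsCMField E := isCMField F E; μ = galConj (IsCMField.complexConj E) ν)
    (hsm : ∀ i : (toThm418Data C (U.rest t)).AdmIndex, IsSmoothRep ((toThm418Data C (U.rest t)).rhoAt i))
    (j : (toThm418Data C ((muConj U).rest tc)).AdmIndex) :
    IsSmoothRep ((toThm418Data C ((muConj U).rest tc)).rhoAt j) := by
  subst h
  exact hsm ((admIndexMuConjEquiv U t tc rfl).symm j)

/-- **Irreducible-or-zero summands transfer likewise** (`μ = νᶜ`; [Liu2021, Def. 4.11] «irreducible», READING I1 `IsIrreducibleOrZero`).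
[cite: Liu2021, Def. 4.11 (FJcycle.tex ll. 2092–2096); Rem. 4.4 (ll. 1912–1930)] -/
theorem isIrreducibleOrZero_rhoAt_muConj_rest {μ ν : Literature.NumberTheory.Automorphic.IdeleClassGroup E →ₜ* Circle}
    {hμ : letI : IsCMField E := isCMField F E; IdeleClassGroup.IsConjugateSymplectic E μ}
    {hν : letI : IsCMField E := isCMField F E; IdeleClassGroup.IsConjugateSymplectic E ν}
    (t : RestTail C μ hμ) (tc : RestTail C ν hν)
    (h : letI : IsCMField E := isCMField F E; μ = galConj (IsCMField.complexConj E) ν)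
    (hirr : ∀ i : (toThm418Data C (U.rest t)).AdmIndex, IsIrreducibleOrZero ((toThm418Data C (U.rest t)).rhoAt i))
    (j : (toThm418Data C ((muConj U).rest tc)).AdmIndex) :
    IsIrreducibleOrZero ((toThm418Data C ((muConj U).rest tc)).rhoAt j) := by
  subst h
  exact hirr ((admIndexMuConjEquiv U t tc rfl).symm j)

/-! ## §2 The A-side pay-off at a conjugate rest without [Def. 4.11] -/

/-- **[Liu2021, Thm. 4.18] AS PRINTED at the `ν`-rest of `muConj U` + an object `D_ν ∈ 𝒜(ν)` + ONE non-zero admissible summand there +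
smooth summands at the `νᶜ`-rest of `U` ⟹ `Hom_E(A_K, A_ν)_ℚ ≠ 0` at every open compact `K` below a threshold `K₀`.**  This is
✔ `Thm418Data.exists_homK_ne_zero_of_isSmoothRep` (Thm. 4.18 main clause + item (1); a non-zero vector of `ω_j` fixed by an open `S`,
`S ∩ K₀(D_ν)` open compact) fed with §1 — the [Def. 4.11]-FREE form of ✔ `Thm418Data.exists_homK_ne_zero_of_def411`, which consumed only
the smoothness conjunct of `Def411AsPrinted`.  `hLiuC` is the consumer's hypothesis; nothing of [Liu2021] is asserted.
[cite: Liu2021, Thm. 4.18 main clause (FJcycle.tex ll. 2233–2237) and (1) (l. 2239); Def. 4.11 (ll. 2092–2096); Rem. 4.4] -/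
theorem exists_homK_ne_zero_muConj_rest_of_isSmoothRep {μ ν : Literature.NumberTheory.Automorphic.IdeleClassGroup E →ₜ* Circle}
    {hμ : letI : IsCMField E := isCMField F E; IdeleClassGroup.IsConjugateSymplectic E μ}
    {hν : letI : IsCMField E := isCMField F E; IdeleClassGroup.IsConjugateSymplectic E ν}
    (t : RestTail C μ hμ) (tc : RestTail C ν hν)
    (h : letI : IsCMField E := isCMField F E; μ = galConj (IsCMField.complexConj E) ν)
    (hsm : ∀ i : (toThm418Data C (U.rest t)).AdmIndex, IsSmoothRep ((toThm418Data C (U.rest t)).rhoAt i))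
    (hLiuC : Thm418AsPrinted (toThm418Data C ((muConj U).rest tc)))
    (Dν : (toThm418Data C ((muConj U).rest tc)).Obj) (j : (toThm418Data C ((muConj U).rest tc)).AdmIndex)
    [Nontrivial ((toThm418Data C ((muConj U).rest tc)).omegaAt j)] :
    ∃ K₀ : Subgroup (toThm418Data C ((muConj U).rest tc)).G, IsOpenCompact K₀ ∧
      ∀ K : Subgroup (toThm418Data C ((muConj U).rest tc)).G, IsOpenCompact K → K ≤ K₀ →
        ∃ φ : (toThm418Data C ((muConj U).rest tc)).HomK K Dν, φ ≠ 0 :=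
  Thm418Data.exists_homK_ne_zero_of_isSmoothRep hLiuC Dν j (isSmoothRep_rhoAt_muConj_rest U t tc h hsm j)

end Generic

/-! ## §3 At the model's μ-uniform carriers `Model.uniformOmegaRep … δ′ r`: smoothness at the conjugate rests is a theorem -/

section Model

open Literature.AlgebraicGeometry.Motives
open Literature.AlgebraicGeometry.ShimuraVarieties.UnitaryCanonicalModel
open Literature.NumberTheory.Automorphic.Liu2021.AppendixC.RestOne
open Literature.NumberTheory.Automorphic.Liu2021.Def411WeilCarriers (Rep)
open Literature.NumberTheory.GelbartRogawski1991 Literature.NumberTheory.GelbartRogawski1991.UnitaryDualPair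
open Literature.NumberTheory.ComplexMultiplication
open Literature.RepresentationTheory.Liu2021
open Summit.HodgeConjecture.CorCM.Model Summit.HodgeConjecture.CorCM.Transposition

set_option maxHeartbeats 2000000 in
-- (the `restTailOne` tails carry the `splittingDatum` telescope of `restOfCharRep`, as in ✔ `Item6UniformOmegaRep.restOfCharRep_eq_rest`)
/-- **SMOOTH BY VALUE at every conjugate rest of the model.**  For `U := Model.uniformOmegaRep h F ι₁ V Φ e dV hdV hdV0 ιV δ′ r` with `ιV`
continuous: every summand of [Liu2021, Thm. 4.18]'s direct sum at the `ν`-rest `(muConj U).rest (restTailOne … ν …)` (the rest at which the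
END displays `hLiuC`) is SMOOTH — it is `U`'s summand `ω(νᶜ, ε, χ)` on the line `⟨r νᶜ _ ε⟩`, whose `𝔾(𝔸_F^∞)`-action through `ιV` is smooth by
✔ `rhoAt_restOfCharRep_smooth` ([GR91, Prop. 3.1.1]: locally constant splittings; `restOfCharRep … = U.rest (restTailOne …)` is ✔
`restOfCharRep_eq_rest`, `rfl`).  No citation is consumed. [cite: Liu2021, Def. 4.11 (FJcycle.tex ll. 2092–2096), Rem. 4.4 (ll. 1912–1930)]
[cite: GelbartRogawski1991, §3.1 Prop. 3.1.1 p. 455 L1–3] -/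
theorem _root_.Summit.HodgeConjecture.CorCM.Model.rhoAt_muConj_uniformOmegaRep_rest_smooth
    (h : exists_recordSystem) (F : CMField) [IsGalois ℚ F] (h6 : 6 ≤ Module.finrank ℚ F)
    (ι₁ : F →+* ℂ) (V : HermSpace3 F ι₁) (Φ : CMType F) {n : ℕ} (e : Fin 3 × Fin 1 ≃ Fin n) (dV : Fin 3 → F)
    (hdV : ∀ i, IsCMField.complexConj F (dV i) = dV i) (hdV0 : ∀ i, dV i ≠ 0)
    (ιV : (sec42DataOf h isoOf F ι₁ V Φ).G →*
      UnitaryGroup.finAdelic ↥(maximalRealSubfield F) F (IsCMField.complexConj F) 3 (Matrix.diagonal dV))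
    (δ' : F) (r : ∀ μ : Literature.NumberTheory.Automorphic.IdeleClassGroup F →ₜ* Circle,
      IdeleClassGroup.IsConjugateSymplectic F μ → Rep ↥(maximalRealSubfield F) (imagUnitSq F))
    (hιc : Continuous ιV)
    (ν : Literature.NumberTheory.Automorphic.IdeleClassGroup F →ₜ* Circle) (hν : IdeleClassGroup.IsConjugateSymplectic F ν)
    (hw : IdeleClassGroup.HasWeight F ν 1)
    (j : (toThm418Data (sec42DataOf h isoOf F ι₁ V Φ) ((muConj (uniformOmegaRep h F ι₁ V Φ e dV hdV hdV0 ιV δ' r)).rest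
      (restTailOne (AlgHom.id ℚ F) ι₁ hν hw (Def45.Carriers.ofPolDR ν (Def45.PolDR ι₁ hν (Def45.RMuForm ι₁ hν)))
        ((heckeTranslatesFamilyOf heckeTranslate_definedOver_holds h isoOf F ι₁ V Φ h6).rhoΩOne (AlgHom.id ℚ F) ι₁ hν hw
          (Def45.Carriers.ofPolDR ν (Def45.PolDR ι₁ hν (Def45.RMuForm ι₁ hν))))))).AdmIndex) :
    IsSmoothRep ((toThm418Data (sec42DataOf h isoOf F ι₁ V Φ) ((muConj (uniformOmegaRep h F ι₁ V Φ e dV hdV hdV0 ιV δ' r)).rest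
      (restTailOne (AlgHom.id ℚ F) ι₁ hν hw (Def45.Carriers.ofPolDR ν (Def45.PolDR ι₁ hν (Def45.RMuForm ι₁ hν)))
        ((heckeTranslatesFamilyOf heckeTranslate_definedOver_holds h isoOf F ι₁ V Φ h6).rhoΩOne (AlgHom.id ℚ F) ι₁ hν hw
          (Def45.Carriers.ofPolDR ν (Def45.PolDR ι₁ hν (Def45.RMuForm ι₁ hν))))))).rhoAt j) :=
  isSmoothRep_rhoAt_muConj_rest (uniformOmegaRep h F ι₁ V Φ e dV hdV hdV0 ιV δ' r)
    (restTailOne (AlgHom.id ℚ F) ι₁ hν.galConj hw.galConj_complexConj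
      (Def45.Carriers.ofPolDR (galConj (IsCMField.complexConj F) ν) (Def45.PolDR ι₁ hν.galConj (Def45.RMuForm ι₁ hν.galConj)))
      ((heckeTranslatesFamilyOf heckeTranslate_definedOver_holds h isoOf F ι₁ V Φ h6).rhoΩOne (AlgHom.id ℚ F) ι₁ hν.galConj
        hw.galConj_complexConj
        (Def45.Carriers.ofPolDR (galConj (IsCMField.complexConj F) ν) (Def45.PolDR ι₁ hν.galConj (Def45.RMuForm ι₁ hν.galConj)))))
    (restTailOne (AlgHom.id ℚ F) ι₁ hν hw (Def45.Carriers.ofPolDR ν (Def45.PolDR ι₁ hν (Def45.RMuForm ι₁ hν)))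
      ((heckeTranslatesFamilyOf heckeTranslate_definedOver_holds h isoOf F ι₁ V Φ h6).rhoΩOne (AlgHom.id ℚ F) ι₁ hν hw
        (Def45.Carriers.ofPolDR ν (Def45.PolDR ι₁ hν (Def45.RMuForm ι₁ hν)))))
    rfl
    (fun i v => rhoAt_restOfCharRep_smooth h F h6 ι₁ V Φ e dV hdV hdV0 ιV δ' (r _ hν.galConj) _ hν.galConj hw.galConj_complexConj hιc i v)
    j

set_option maxHeartbeats 2000000 in
-- (as above)
/-- **THE A-SIDE PAY-OFF AT THE MODEL WITHOUT [Def. 4.11].**  For `U := Model.uniformOmegaRep … δ′ r` (`ιV` continuous) and a conjugate-symplectic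
weight-one `ν`: [Liu2021, Thm. 4.18] AS PRINTED at the conjugate rest `(muConj U).rest (restTailOne … ν …)` (`hLiuC`, ONE value of the END's
displayed family), an object `D_ν ∈ 𝒜(ν)` and ONE non-zero admissible summand there ⟹ `Hom_E(A_K, A_ν)_ℚ ≠ 0` at every open compact `K`
below a threshold — smoothness being ✔ `Model.rhoAt_muConj_uniformOmegaRep_rest_smooth`.  `hLiuC` is a hypothesis; nothing is asserted.
[cite: Liu2021, Thm. 4.18 main clause (FJcycle.tex ll. 2233–2237) and (1) (l. 2239); Def. 4.11 (ll. 2092–2096); Rem. 4.4]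
[cite: GelbartRogawski1991, §3.1 Prop. 3.1.1 p. 455 L1–3] -/
theorem _root_.Summit.HodgeConjecture.CorCM.Model.exists_homK_ne_zero_muConj_uniformOmegaRep_rest
    (h : exists_recordSystem) (F : CMField) [IsGalois ℚ F] (h6 : 6 ≤ Module.finrank ℚ F)
    (ι₁ : F →+* ℂ) (V : HermSpace3 F ι₁) (Φ : CMType F) {n : ℕ} (e : Fin 3 × Fin 1 ≃ Fin n) (dV : Fin 3 → F)
    (hdV : ∀ i, IsCMField.complexConj F (dV i) = dV i) (hdV0 : ∀ i, dV i ≠ 0)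
    (ιV : (sec42DataOf h isoOf F ι₁ V Φ).G →*
      UnitaryGroup.finAdelic ↥(maximalRealSubfield F) F (IsCMField.complexConj F) 3 (Matrix.diagonal dV))
    (δ' : F) (r : ∀ μ : Literature.NumberTheory.Automorphic.IdeleClassGroup F →ₜ* Circle,
      IdeleClassGroup.IsConjugateSymplectic F μ → Rep ↥(maximalRealSubfield F) (imagUnitSq F))
    (hιc : Continuous ιV)
    (ν : Literature.NumberTheory.Automorphic.IdeleClassGroup F →ₜ* Circle) (hν : IdeleClassGroup.IsConjugateSymplectic F ν)
    (hw : IdeleClassGroup.HasWeight F ν 1)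
    (hLiuC : Thm418AsPrinted (toThm418Data (sec42DataOf h isoOf F ι₁ V Φ) ((muConj (uniformOmegaRep h F ι₁ V Φ e dV hdV hdV0 ιV δ' r)).rest
      (restTailOne (AlgHom.id ℚ F) ι₁ hν hw (Def45.Carriers.ofPolDR ν (Def45.PolDR ι₁ hν (Def45.RMuForm ι₁ hν)))
        ((heckeTranslatesFamilyOf heckeTranslate_definedOver_holds h isoOf F ι₁ V Φ h6).rhoΩOne (AlgHom.id ℚ F) ι₁ hν hw
          (Def45.Carriers.ofPolDR ν (Def45.PolDR ι₁ hν (Def45.RMuForm ι₁ hν))))))))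
    (Dν : (toThm418Data (sec42DataOf h isoOf F ι₁ V Φ) ((muConj (uniformOmegaRep h F ι₁ V Φ e dV hdV hdV0 ιV δ' r)).rest
      (restTailOne (AlgHom.id ℚ F) ι₁ hν hw (Def45.Carriers.ofPolDR ν (Def45.PolDR ι₁ hν (Def45.RMuForm ι₁ hν)))
        ((heckeTranslatesFamilyOf heckeTranslate_definedOver_holds h isoOf F ι₁ V Φ h6).rhoΩOne (AlgHom.id ℚ F) ι₁ hν hw
          (Def45.Carriers.ofPolDR ν (Def45.PolDR ι₁ hν (Def45.RMuForm ι₁ hν))))))).Obj)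
    (j : (toThm418Data (sec42DataOf h isoOf F ι₁ V Φ) ((muConj (uniformOmegaRep h F ι₁ V Φ e dV hdV hdV0 ιV δ' r)).rest
      (restTailOne (AlgHom.id ℚ F) ι₁ hν hw (Def45.Carriers.ofPolDR ν (Def45.PolDR ι₁ hν (Def45.RMuForm ι₁ hν)))
        ((heckeTranslatesFamilyOf heckeTranslate_definedOver_holds h isoOf F ι₁ V Φ h6).rhoΩOne (AlgHom.id ℚ F) ι₁ hν hw
          (Def45.Carriers.ofPolDR ν (Def45.PolDR ι₁ hν (Def45.RMuForm ι₁ hν))))))).AdmIndex)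
    [Nontrivial ((toThm418Data (sec42DataOf h isoOf F ι₁ V Φ) ((muConj (uniformOmegaRep h F ι₁ V Φ e dV hdV hdV0 ιV δ' r)).rest
      (restTailOne (AlgHom.id ℚ F) ι₁ hν hw (Def45.Carriers.ofPolDR ν (Def45.PolDR ι₁ hν (Def45.RMuForm ι₁ hν)))
        ((heckeTranslatesFamilyOf heckeTranslate_definedOver_holds h isoOf F ι₁ V Φ h6).rhoΩOne (AlgHom.id ℚ F) ι₁ hν hw
          (Def45.Carriers.ofPolDR ν (Def45.PolDR ι₁ hν (Def45.RMuForm ι₁ hν))))))).omegaAt j)] :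
    ∃ K₀ : Subgroup (sec42DataOf h isoOf F ι₁ V Φ).G, IsOpenCompact K₀ ∧
      ∀ K : Subgroup (sec42DataOf h isoOf F ι₁ V Φ).G, IsOpenCompact K → K ≤ K₀ →
        ∃ φ : (toThm418Data (sec42DataOf h isoOf F ι₁ V Φ) ((muConj (uniformOmegaRep h F ι₁ V Φ e dV hdV hdV0 ιV δ' r)).rest
          (restTailOne (AlgHom.id ℚ F) ι₁ hν hw (Def45.Carriers.ofPolDR ν (Def45.PolDR ι₁ hν (Def45.RMuForm ι₁ hν)))
            ((heckeTranslatesFamilyOf heckeTranslate_definedOver_holds h isoOf F ι₁ V Φ h6).rhoΩOne (AlgHom.id ℚ F) ι₁ hν hw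
              (Def45.Carriers.ofPolDR ν (Def45.PolDR ι₁ hν (Def45.RMuForm ι₁ hν))))))).HomK K Dν, φ ≠ 0 :=
  Thm418Data.exists_homK_ne_zero_of_isSmoothRep hLiuC Dν j
    (rhoAt_muConj_uniformOmegaRep_rest_smooth h F h6 ι₁ V Φ e dV hdV hdV0 ιV δ' r hιc ν hν hw j)

end Model

end Summit.HodgeConjecture.CorCM.D2Bridge.AdapterMuConj

end
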